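import Mathlib
import Literature.Probability.LatticeModels.ProdBernoulliCoupling
import Summits.CriticalPhenomena.PercolationContinuityZ3.Theorems.PercNearOneGluingNoHeavyLowerTailRelayCoreGluing
import HarnessLib

/-!
# `NoHeavyLowerTail` (stmt-CriticalPhenomena-4575) — INESSENTIAL observers glue at linear rate, at any depth

Support file (hull-port / coupling seat `prim-hp-1` gen 5; `--supports stmt-CriticalPhenomena-4575`).
No definitions, no named facts, no sorries.  Strengthens `nearOneGluing_of_relayCore` (same seat, same
day): there the relays had to be reliable inside `G[A]`; here they only have to stay reliable when the
observer's Steiner region is removed.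

Setting: `μ = prodBernoulli w` on the pairs of `Fin n`, relays `A`, target `b ∈ A`, a Steiner region `R`
disjoint from `A` and closed under positive pairs towards non-relays, an observer `o ∈ R` (any depth).
Call `o` INESSENTIAL at level `t` (inside `R`) if for every `U` with `o ∈ U ⊆ R` and every relay `a`,
`P_{G−U}(a ↔ b) ≥ 1 − t` (`G − U`: all pairs meeting `U` closed) — the relays do not need any part of the
observer's region that the observer can swallow.

* `inessential_blockGluing` — block form by induction with the soft σ-recursion engine
  `sigmaRec_engine_soft`: a layer meeting `A` at `v` reaches `b`, once glued, at least as well as `v` does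
  in `G − O` (monotonicity in the weights), which is `≥ 1 − t` by inessentiality at `U = O`; a Steiner layer
  `S ⊆ R` is the induction hypothesis for the block `S` under `kill_O w` (`kill_{U'} ∘ kill_O = kill_{O ∪ U'}`).
* `nearOneGluing_of_inessential` — **`P(o ↔ A) − t ≤ P(o ↔ b)` for every inessential observer, whatever
  its depth.**

So the crux (Kozma–Nitzan Conj. 3 / near-one gluing with any modulus) is EXACTLY the essential case: relay
routes to the target that run through Steiner vertices the observer itself can reach (memo
HULLPORT-COUPLING.md §43: there the per-pocket comparison relay is forced to depend on the pocket, and no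
single-relay re-summation survives).
-/

namespace Summit.CriticalPhenomena.PercolationContinuityZ3.Theorems

open MeasureTheory Set
open Literature.Probability.LatticeModels (prodBernoulli prodBernoulli_real_mono_of_isUpperSet)
open Literature.Probability.Percolation (BondConfig openConn openGraph isUpperSet_openConn)

noncomputable section
open Classical

variable {n : ℕ}

/-- The block-deleted weights are dominated by every layer world above them:
`kill_O w ≤ glue_S (kill_O w)` pointwise. [folklore] -/
theorem inessential_kill_le_layerWorld (w : Sym2 (Fin n) → unitInterval) (O S : Finset (Fin n)) :
    (fun e : Sym2 (Fin n) => if (∃ x ∈ e, x ∈ O) then (0 : unitInterval) else w e) ≤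
      (fun e : Sym2 (Fin n) => if (∀ x ∈ e, x ∈ S) ∧ ¬ e.IsDiag then 1 else
        if (∃ x ∈ e, x ∈ O) then 0 else w e) := by
  intro e
  dsimp only
  by_cases hS : (∀ x ∈ e, x ∈ S) ∧ ¬ e.IsDiag
  · rw [if_pos hS]
    exact le_top
  · rw [if_neg hS]

/-- **Inessential observer blocks glue at linear rate (block form, any depth).**  Relays `A`, `b ∈ A`,
`0 ≤ t`, a region `R` disjoint from `A`.  For every `m`, every weight function `w` under which `R` is closed
(every positive pair from `R` to a non-relay stays in `R`) and every block `O ⊆ R` with at most `m` active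
non-relay vertices outside `O`: if `P_{kill_U w}(a ↔ b) ≥ 1 − t` for every `O ⊆ U ⊆ R` and every relay `a`,
then `μ_{glue O}(O ↔ A) − μ_{glue O}(O ↔ b) ≤ t`.
[cite: KozmaNitzan2024, proofs of Thms 4–5 (pp. 13–14) — σ-recursion bookkeeping] -/
theorem inessential_blockGluing (A : Finset (Fin n)) (b : Fin n) (hbA : b ∈ A) (t : ℝ) (ht : 0 ≤ t)
    (R : Finset (Fin n)) (hRA : Disjoint R A) :
    ∀ (m : ℕ) (w : Sym2 (Fin n) → unitInterval) (O : Finset (Fin n)), O ⊆ R →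
      (∀ x ∈ R, ∀ y : Fin n, y ∉ R → y ∉ A → w s(x, y) = 0) →
      (∀ U : Finset (Fin n), O ⊆ U → U ⊆ R → ∀ a ∈ A, 1 - t ≤
        (prodBernoulli (fun e : Sym2 (Fin n) => if (∃ x ∈ e, x ∈ U) then 0 else w e)).real
          (openConn a b)) →
      (Finset.univ.filter fun x : Fin n =>
          x ∉ A ∧ x ∉ O ∧ ∃ y : Fin n, w s(x, y) ≠ 0).card ≤ m →
      (prodBernoulli (fun e : Sym2 (Fin n) =>
          if (∀ x ∈ e, x ∈ O) ∧ ¬ e.IsDiag then 1 else w e)).real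
          (⋃ o ∈ O, ⋃ x ∈ A, openConn o x) -
        (prodBernoulli (fun e : Sym2 (Fin n) =>
          if (∀ x ∈ e, x ∈ O) ∧ ¬ e.IsDiag then 1 else w e)).real
          (⋃ o ∈ O, openConn o b) ≤ t := by
  intro m
  induction m with
  | zero =>
    intro w O hOR hclosed hrel hcard
    exact step w O hOR hclosed hrel (fun S hS hSne hSA => by
      exfalso
      obtain ⟨x, hx⟩ := hSne
      obtain ⟨hxO, o, ho, hw⟩ := hS x hx
      have hxA : x ∉ A := Finset.disjoint_left.1 hSA hx
      have hmem : x ∈ Finset.univ.filter fun x : Fin n =>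
          x ∉ A ∧ x ∉ O ∧ ∃ y : Fin n, w s(x, y) ≠ 0 :=
        Finset.mem_filter.2 ⟨Finset.mem_univ _, hxA, hxO, o, by rwa [Sym2.eq_swap]⟩
      have := Finset.card_pos.2 ⟨x, hmem⟩
      omega)
  | succ m ih =>
    intro w O hOR hclosed hrel hcard
    exact step w O hOR hclosed hrel (fun S hS hSne hSA => by
      have hSR : S ⊆ R := by
        intro x hx
        obtain ⟨hxO, o, ho, hw⟩ := hS x hx
        by_contra hxR
        exact hw (hclosed o (hOR ho) x hxR (Finset.disjoint_left.1 hSA hx))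
      refine ih (fun e : Sym2 (Fin n) => if (∃ x ∈ e, x ∈ O) then 0 else w e) S hSR ?_ ?_ ?_
      · intro x hx y hyR hyA
        show (if (∃ z ∈ s(x, y), z ∈ O) then (0 : unitInterval) else w s(x, y)) = 0
        rw [hclosed x hx y hyR hyA]
        split_ifs <;> rfl
      · intro U' hSU' hU'R a ha
        -- `kill_{U'} (kill_O w) = kill_{O ∪ U'} w`
        have hkk : (fun e : Sym2 (Fin n) => if (∃ x ∈ e, x ∈ U') then (0 : unitInterval) else
            (if (∃ x ∈ e, x ∈ O) then 0 else w e)) =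
            (fun e : Sym2 (Fin n) => if (∃ x ∈ e, x ∈ O ∪ U') then 0 else w e) := by
          funext e
          by_cases h1 : ∃ x ∈ e, x ∈ U'
          · obtain ⟨x, hx, hxU⟩ := h1
            rw [if_pos ⟨x, hx, hxU⟩, if_pos ⟨x, hx, Finset.mem_union_right O hxU⟩]
          · rw [if_neg h1]
            by_cases h2 : ∃ x ∈ e, x ∈ O
            · obtain ⟨x, hx, hxO⟩ := h2
              rw [if_pos ⟨x, hx, hxO⟩, if_pos ⟨x, hx, Finset.mem_union_left U' hxO⟩]
            · rw [if_neg h2, if_neg]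
              rintro ⟨x, hx, hxOU⟩
              rcases Finset.mem_union.1 hxOU with h | h
              · exact h2 ⟨x, hx, h⟩
              · exact h1 ⟨x, hx, h⟩
        rw [hkk]
        exact hrel (O ∪ U') Finset.subset_union_left (Finset.union_subset hOR hU'R) a ha
      · have hsub : (Finset.univ.filter fun x : Fin n =>
              x ∉ A ∧ x ∉ S ∧ ∃ y : Fin n,
                (if (∃ z ∈ s(x, y), z ∈ O) then (0 : unitInterval) else w s(x, y)) ≠ 0) ⊂
            (Finset.univ.filter fun x : Fin n => x ∉ A ∧ x ∉ O ∧ ∃ y : Fin n, w s(x, y) ≠ 0) := by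
          rw [Finset.ssubset_iff_subset_ne]
          refine ⟨fun x hx => ?_, fun heq => ?_⟩
          · obtain ⟨-, hxA, hxS, y, hy⟩ := Finset.mem_filter.1 hx
            have hO : ¬ (∃ z ∈ s(x, y), z ∈ O) := fun h => hy (by rw [if_pos h])
            rw [if_neg hO] at hy
            exact Finset.mem_filter.2 ⟨Finset.mem_univ _, hxA,
              fun hxO => hO ⟨x, Sym2.mem_mk_left x y, hxO⟩, y, hy⟩
          · obtain ⟨x, hx⟩ := hSne
            obtain ⟨hxO, o, ho, hw⟩ := hS x hx
            have hxA : x ∉ A := Finset.disjoint_left.1 hSA hx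
            have hmem : x ∈ Finset.univ.filter fun x : Fin n =>
                x ∉ A ∧ x ∉ O ∧ ∃ y : Fin n, w s(x, y) ≠ 0 :=
              Finset.mem_filter.2 ⟨Finset.mem_univ _, hxA, hxO, o, by rwa [Sym2.eq_swap]⟩
            rw [← heq] at hmem
            exact (Finset.mem_filter.1 hmem).2.2.1 hx
        have hlt := Finset.card_lt_card hsub
        omega)
  where
  /-- One application of the soft engine at the block `O`, given the bound on Steiner layers. -/
  step (w : Sym2 (Fin n) → unitInterval) (O : Finset (Fin n)) (hOR : O ⊆ R)
      (hclosed : ∀ x ∈ R, ∀ y : Fin n, y ∉ R → y ∉ A → w s(x, y) = 0)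
      (hrel : ∀ U : Finset (Fin n), O ⊆ U → U ⊆ R → ∀ a ∈ A, 1 - t ≤
        (prodBernoulli (fun e : Sym2 (Fin n) => if (∃ x ∈ e, x ∈ U) then 0 else w e)).real
          (openConn a b))
      (hSteiner : ∀ S : Finset (Fin n), (∀ x ∈ S, x ∉ O ∧ ∃ o ∈ O, w s(o, x) ≠ 0) →
        S.Nonempty → Disjoint S A →
        (prodBernoulli (fun e : Sym2 (Fin n) =>
            if (∀ x ∈ e, x ∈ S) ∧ ¬ e.IsDiag then 1 else
              if (∃ x ∈ e, x ∈ O) then 0 else w e)).real (⋃ s ∈ S, ⋃ x ∈ A, openConn s x) -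
          (prodBernoulli (fun e : Sym2 (Fin n) =>
            if (∀ x ∈ e, x ∈ S) ∧ ¬ e.IsDiag then 1 else
              if (∃ x ∈ e, x ∈ O) then 0 else w e)).real (⋃ s ∈ S, openConn s b) ≤ t) :
      (prodBernoulli (fun e : Sym2 (Fin n) =>
          if (∀ x ∈ e, x ∈ O) ∧ ¬ e.IsDiag then 1 else w e)).real
          (⋃ o ∈ O, ⋃ x ∈ A, openConn o x) -
        (prodBernoulli (fun e : Sym2 (Fin n) =>
          if (∀ x ∈ e, x ∈ O) ∧ ¬ e.IsDiag then 1 else w e)).real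
          (⋃ o ∈ O, openConn o b) ≤ t := by
    have hOA : Disjoint O A := Finset.disjoint_of_subset_left hOR hRA
    have hbO : b ∉ O := fun h => Finset.disjoint_left.1 hOA h hbA
    refine sigmaRec_engine_soft w
      (fun e : Sym2 (Fin n) => if (∀ x ∈ e, x ∈ O) ∧ ¬ e.IsDiag then 1 else w e)
      (fun (S : Finset (Fin n)) (e : Sym2 (Fin n)) =>
        if (∀ x ∈ e, x ∈ S) ∧ ¬ e.IsDiag then 1 else if (∃ x ∈ e, x ∈ O) then 0 else w e)
      O A b t
      (fun (S : Finset (Fin n)) (ω : BondConfig (Fin n)) =>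
        {e | e ∈ ω ∧ ∀ x ∈ e, x ∉ O} ∪ {e | (∀ x ∈ e, x ∈ S) ∧ ¬ e.IsDiag})
      {ω | ∀ o ∈ O, ∀ o' ∈ O, o ≠ o' → s(o, o') ∈ ω} ?_ ?_ ?_ ?_ (stub_sigmaLaw n w O) ht ?_ ?_
    · intro ω hω
      simp only [Set.mem_setOf_eq] at hω
      push Not at hω
      obtain ⟨o, ho, o', ho', hne, hnot⟩ := hω
      refine ⟨s(o, o'), ?_, hnot⟩
      show (if (∀ y ∈ s(o, o'), y ∈ O) ∧ ¬ (s(o, o')).IsDiag then (1 : unitInterval)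
        else w s(o, o')) = 1
      rw [if_pos]
      refine ⟨fun y hy => ?_, fun hd => hne (Sym2.mk_isDiag_iff.1 hd)⟩
      rcases Sym2.mem_iff.1 hy with rfl | rfl <;> assumption
    · intro o x hx
      show (if (∀ y ∈ s(o, x), y ∈ O) ∧ ¬ (s(o, x)).IsDiag then (1 : unitInterval)
        else w s(o, x)) = w s(o, x)
      rw [if_neg]
      rintro ⟨h, -⟩
      exact hx (h x (Sym2.mem_mk_right o x))
    · intro S ω hL hK
      exact (stub_sigmaGeometry n O S ω hL hK).1 A hOA
    · intro S ω hL hK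
      have h := (stub_sigmaGeometry n O S ω hL hK).1 {b} (Finset.disjoint_singleton_right.2 hbO)
      simpa only [Finset.set_biUnion_singleton] using h
    · -- a positive layer meeting `A` at `v`: `v` is `(1−t)`-reliable already in `G − O`
      intro S _hS hSA hbS
      obtain ⟨v, hv⟩ := hSA
      have hvS : v ∈ S := (Finset.mem_inter.1 hv).1
      have hvA : v ∈ A := (Finset.mem_inter.1 hv).2
      have h1 := hrel O (Finset.Subset.refl O) hOR v hvA
      have h2 : (prodBernoulli (fun e : Sym2 (Fin n) => if (∃ x ∈ e, x ∈ O) then 0 else w e)).real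
            (openConn v b) ≤
          (prodBernoulli (fun e : Sym2 (Fin n) =>
            if (∀ x ∈ e, x ∈ S) ∧ ¬ e.IsDiag then 1 else
              if (∃ x ∈ e, x ∈ O) then 0 else w e)).real (openConn v b) :=
        prodBernoulli_real_mono_of_isUpperSet (inessential_kill_le_layerWorld w O S)
          (isUpperSet_openConn v b) MeasurableSet.of_discrete
      have h3 : (prodBernoulli (fun e : Sym2 (Fin n) =>
            if (∀ x ∈ e, x ∈ S) ∧ ¬ e.IsDiag then 1 else
              if (∃ x ∈ e, x ∈ O) then 0 else w e)).real (openConn v b) ≤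
          (prodBernoulli (fun e : Sym2 (Fin n) =>
            if (∀ x ∈ e, x ∈ S) ∧ ¬ e.IsDiag then 1 else
              if (∃ x ∈ e, x ∈ O) then 0 else w e)).real (⋃ s ∈ S, openConn s b) :=
        measureReal_mono (fun ω hω => Set.mem_iUnion₂.2 ⟨v, hvS, hω⟩) (measure_ne_top _ _)
      linarith
    · intro S hS hSne hSA _hbS
      exact hSteiner S hS hSne hSA

/-- **Inessential observers glue at linear rate, whatever their depth.**  `μ = prodBernoulli w` on `Fin n`,
relays `A`, `b ∈ A`, `0 ≤ t`, a region `R ∋ o` disjoint from `A` and closed under positive pairs towards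
non-relays (e.g. the non-relay part of the component of `o` in `G ∖ A`).  If the relays are `(1−t)`-reliable
WITHOUT any part of the region the observer can swallow — `P_{G−U}(a ↔ b) ≥ 1 − t` for all `o ∈ U ⊆ R`,
`a ∈ A` — then `P(o ↔ A) − t ≤ P(o ↔ b)`.  Hence the crux's near-one gluing is exactly the ESSENTIAL case.
[cite: KozmaNitzan2024, Conj. 3 (p. 15) and Thm. 4 (pp. 12–14) — context] -/
theorem nearOneGluing_of_inessential (n : ℕ) (w : Sym2 (Fin n) → unitInterval) (A R : Finset (Fin n))
    (o b : Fin n) (t : ℝ) (hoR : o ∈ R) (hRA : Disjoint R A) (hbA : b ∈ A) (ht : 0 ≤ t)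
    (hclosed : ∀ x ∈ R, ∀ y : Fin n, y ∉ R → y ∉ A → w s(x, y) = 0)
    (hrel : ∀ U : Finset (Fin n), o ∈ U → U ⊆ R → ∀ a ∈ A, 1 - t ≤
      (prodBernoulli (fun e : Sym2 (Fin n) => if (∃ x ∈ e, x ∈ U) then 0 else w e)).real
        (openConn a b)) :
    (prodBernoulli w).real (⋃ a ∈ A, openConn o a) - t ≤ (prodBernoulli w).real (openConn o b) := by
  have key := inessential_blockGluing A b hbA t ht R hRA n w {o} (Finset.singleton_subset_iff.2 hoR)
    hclosed (fun U hoU hUR a ha => hrel U (Finset.singleton_subset_iff.1 hoU) hUR a ha)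
    ((Finset.card_le_univ _).trans (Fintype.card_fin n).le)
  rw [goodStep24_glue_singleton, Finset.set_biUnion_singleton, Finset.set_biUnion_singleton] at key
  linarith

end

end Summit.CriticalPhenomena.PercolationContinuityZ3.Theorems
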